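import Summits.Ventures.QEC.Census.HB.HB90b.BZStructX
import Summits.Ventures.QEC.Census.HB.HB90b.BZBoundsX
import Summits.Ventures.QEC.Census.HB.HB90b.BZInfoSetsX1
import Summits.Ventures.QEC.Census.HB.HB90b.BZEnumX01
import Summits.Ventures.QEC.Census.HB.HB90b.BZEnumX02
import Summits.Ventures.QEC.Census.HB.HB90b.BZEnumX03
import Summits.Ventures.QEC.Census.HB.HB90b.BZEnumX04
import Summits.Ventures.QEC.Census.CertCheckBZSound
import Summits.Ventures.QEC.Census.CertChunks
import HarnessLib

/-!
# `HB90b` — `bz` certificate, side X: ASSEMBLY `d_X = 8` (tier KERNEL (CERTIFIED); emitted by qec-search-7)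

`(cert.code _).dX = 8` for the CSS code of the certificate (`Fin 90`, check matrices `rowMatrix 90 cert.HX/HZ`) by
type-10's `DistCert.dX_code_of_bz` (`Census/CertCheckBZSound.lean`: structural check of the distance certificate +
`bzXStruct` + `bzXLen` + every block) with each block recombined from its KERNEL information-set facts
(`BZInfoSetsX*`), its enumeration verdicts (`BZEnumX*`) and its bound (`BZBoundsX`) by
`CertBZInfoSets.bzXBlock_of_parts`.
-/

namespace Summit.Ventures.QEC.Census.HB90b

/-- Block 0 of side X passes type-10's block check (from its parts). -/
theorem blkX_0 : HB90b.cert.bzXBlock HB90b.bzData 0 = true :=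
  cert.bzXBlock_of_parts bzData (b := 0) (blk := bzBlockX0) rfl rfl
    (forall_lt_append (forall_lt_append (forall_lt_zero) (forall_lt_single 0 sysX_0_0)) (forall_lt_single 1 sysX_0_1))
    (forall_lt_append (forall_lt_append (forall_lt_zero) (forall_lt_single 0 enumX_0_0)) (forall_lt_single 1 enumX_0_1))
    boundX_0

/-- Block 1 of side X passes type-10's block check (from its parts). -/
theorem blkX_1 : HB90b.cert.bzXBlock HB90b.bzData 1 = true :=
  cert.bzXBlock_of_parts bzData (b := 1) (blk := bzBlockX1) rfl rfl
    (forall_lt_append (forall_lt_append (forall_lt_zero) (forall_lt_single 0 sysX_1_0)) (forall_lt_single 1 sysX_1_1))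
    (forall_lt_append (forall_lt_append (forall_lt_zero) (forall_lt_single 0 enumX_1_0)) (forall_lt_single 1 enumX_1_1))
    boundX_1

/-- Block 2 of side X passes type-10's block check (from its parts). -/
theorem blkX_2 : HB90b.cert.bzXBlock HB90b.bzData 2 = true :=
  cert.bzXBlock_of_parts bzData (b := 2) (blk := bzBlockX2) rfl rfl
    (forall_lt_append (forall_lt_append (forall_lt_zero) (forall_lt_single 0 sysX_2_0)) (forall_lt_single 1 sysX_2_1))
    (forall_lt_append (forall_lt_append (forall_lt_zero) (forall_lt_single 0 enumX_2_0)) (forall_lt_single 1 enumX_2_1))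
    boundX_2

/-- Block 3 of side X passes type-10's block check (from its parts). -/
theorem blkX_3 : HB90b.cert.bzXBlock HB90b.bzData 3 = true :=
  cert.bzXBlock_of_parts bzData (b := 3) (blk := bzBlockX3) rfl rfl
    (forall_lt_append (forall_lt_append (forall_lt_zero) (forall_lt_single 0 sysX_3_0)) (forall_lt_single 1 sysX_3_1))
    (forall_lt_append (forall_lt_append (forall_lt_zero) (forall_lt_single 0 enumX_3_0)) (forall_lt_single 1 enumX_3_1))
    boundX_3

/-- Block 4 of side X passes type-10's block check (from its parts). -/
theorem blkX_4 : HB90b.cert.bzXBlock HB90b.bzData 4 = true :=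
  cert.bzXBlock_of_parts bzData (b := 4) (blk := bzBlockX4) rfl rfl
    (forall_lt_append (forall_lt_append (forall_lt_zero) (forall_lt_single 0 sysX_4_0)) (forall_lt_single 1 sysX_4_1))
    (forall_lt_append (forall_lt_append (forall_lt_zero) (forall_lt_single 0 enumX_4_0)) (forall_lt_single 1 enumX_4_1))
    boundX_4

/-- Block 5 of side X passes type-10's block check (from its parts). -/
theorem blkX_5 : HB90b.cert.bzXBlock HB90b.bzData 5 = true :=
  cert.bzXBlock_of_parts bzData (b := 5) (blk := bzBlockX5) rfl rfl
    (forall_lt_append (forall_lt_append (forall_lt_zero) (forall_lt_single 0 sysX_5_0)) (forall_lt_single 1 sysX_5_1))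
    (forall_lt_append (forall_lt_append (forall_lt_zero) (forall_lt_single 0 enumX_5_0)) (forall_lt_single 1 enumX_5_1))
    boundX_5

/-- Block 6 of side X passes type-10's block check (from its parts). -/
theorem blkX_6 : HB90b.cert.bzXBlock HB90b.bzData 6 = true :=
  cert.bzXBlock_of_parts bzData (b := 6) (blk := bzBlockX6) rfl rfl
    (forall_lt_append (forall_lt_append (forall_lt_zero) (forall_lt_single 0 sysX_6_0)) (forall_lt_single 1 sysX_6_1))
    (forall_lt_append (forall_lt_append (forall_lt_zero) (forall_lt_single 0 enumX_6_0)) (forall_lt_single 1 enumX_6_1))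
    boundX_6

/-- Block 7 of side X passes type-10's block check (from its parts). -/
theorem blkX_7 : HB90b.cert.bzXBlock HB90b.bzData 7 = true :=
  cert.bzXBlock_of_parts bzData (b := 7) (blk := bzBlockX7) rfl rfl
    (forall_lt_append (forall_lt_append (forall_lt_zero) (forall_lt_single 0 sysX_7_0)) (forall_lt_single 1 sysX_7_1))
    (forall_lt_append (forall_lt_append (forall_lt_zero) (forall_lt_single 0 enumX_7_0)) (forall_lt_single 1 enumX_7_1))
    boundX_7

/-- Block 8 of side X passes type-10's block check (from its parts). -/
theorem blkX_8 : HB90b.cert.bzXBlock HB90b.bzData 8 = true :=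
  cert.bzXBlock_of_parts bzData (b := 8) (blk := bzBlockX8) rfl rfl
    (forall_lt_append (forall_lt_append (forall_lt_zero) (forall_lt_single 0 sysX_8_0)) (forall_lt_single 1 sysX_8_1))
    (forall_lt_append (forall_lt_append (forall_lt_zero) (forall_lt_single 0 enumX_8_0)) (forall_lt_single 1 enumX_8_1))
    boundX_8

/-- Block 9 of side X passes type-10's block check (from its parts). -/
theorem blkX_9 : HB90b.cert.bzXBlock HB90b.bzData 9 = true :=
  cert.bzXBlock_of_parts bzData (b := 9) (blk := bzBlockX9) rfl rfl
    (forall_lt_append (forall_lt_append (forall_lt_zero) (forall_lt_single 0 sysX_9_0)) (forall_lt_single 1 sysX_9_1))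
    (forall_lt_append (forall_lt_append (forall_lt_zero) (forall_lt_single 0 enumX_9_0)) (forall_lt_single 1 enumX_9_1))
    boundX_9

/-- Block 10 of side X passes type-10's block check (from its parts). -/
theorem blkX_10 : HB90b.cert.bzXBlock HB90b.bzData 10 = true :=
  cert.bzXBlock_of_parts bzData (b := 10) (blk := bzBlockX10) rfl rfl
    (forall_lt_append (forall_lt_append (forall_lt_zero) (forall_lt_single 0 sysX_10_0)) (forall_lt_single 1 sysX_10_1))
    (forall_lt_append (forall_lt_append (forall_lt_zero) (forall_lt_single 0 enumX_10_0)) (forall_lt_single 1 enumX_10_1))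
    boundX_10

/-- Block 11 of side X passes type-10's block check (from its parts). -/
theorem blkX_11 : HB90b.cert.bzXBlock HB90b.bzData 11 = true :=
  cert.bzXBlock_of_parts bzData (b := 11) (blk := bzBlockX11) rfl rfl
    (forall_lt_append (forall_lt_append (forall_lt_zero) (forall_lt_single 0 sysX_11_0)) (forall_lt_single 1 sysX_11_1))
    (forall_lt_append (forall_lt_append (forall_lt_zero) (forall_lt_single 0 enumX_11_0)) (forall_lt_single 1 enumX_11_1))
    boundX_11

/-- Block 12 of side X passes type-10's block check (from its parts). -/
theorem blkX_12 : HB90b.cert.bzXBlock HB90b.bzData 12 = true :=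
  cert.bzXBlock_of_parts bzData (b := 12) (blk := bzBlockX12) rfl rfl
    (forall_lt_append (forall_lt_append (forall_lt_zero) (forall_lt_single 0 sysX_12_0)) (forall_lt_single 1 sysX_12_1))
    (forall_lt_append (forall_lt_append (forall_lt_zero) (forall_lt_single 0 enumX_12_0)) (forall_lt_single 1 enumX_12_1))
    boundX_12

/-- Block 13 of side X passes type-10's block check (from its parts). -/
theorem blkX_13 : HB90b.cert.bzXBlock HB90b.bzData 13 = true :=
  cert.bzXBlock_of_parts bzData (b := 13) (blk := bzBlockX13) rfl rfl
    (forall_lt_append (forall_lt_append (forall_lt_zero) (forall_lt_single 0 sysX_13_0)) (forall_lt_single 1 sysX_13_1))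
    (forall_lt_append (forall_lt_append (forall_lt_zero) (forall_lt_single 0 enumX_13_0)) (forall_lt_single 1 enumX_13_1))
    boundX_13

/-- Block 14 of side X passes type-10's block check (from its parts). -/
theorem blkX_14 : HB90b.cert.bzXBlock HB90b.bzData 14 = true :=
  cert.bzXBlock_of_parts bzData (b := 14) (blk := bzBlockX14) rfl rfl
    (forall_lt_append (forall_lt_append (forall_lt_zero) (forall_lt_single 0 sysX_14_0)) (forall_lt_single 1 sysX_14_1))
    (forall_lt_append (forall_lt_append (forall_lt_zero) (forall_lt_single 0 enumX_14_0)) (forall_lt_single 1 enumX_14_1))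
    boundX_14

/-- Block 15 of side X passes type-10's block check (from its parts). -/
theorem blkX_15 : HB90b.cert.bzXBlock HB90b.bzData 15 = true :=
  cert.bzXBlock_of_parts bzData (b := 15) (blk := bzBlockX15) rfl rfl
    (forall_lt_append (forall_lt_append (forall_lt_zero) (forall_lt_single 0 sysX_15_0)) (forall_lt_single 1 sysX_15_1))
    (forall_lt_append (forall_lt_append (forall_lt_zero) (forall_lt_single 0 enumX_15_0)) (forall_lt_single 1 enumX_15_1))
    boundX_15

/-- Block 16 of side X passes type-10's block check (from its parts). -/
theorem blkX_16 : HB90b.cert.bzXBlock HB90b.bzData 16 = true :=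
  cert.bzXBlock_of_parts bzData (b := 16) (blk := bzBlockX16) rfl rfl
    (forall_lt_append (forall_lt_append (forall_lt_zero) (forall_lt_single 0 sysX_16_0)) (forall_lt_single 1 sysX_16_1))
    (forall_lt_append (forall_lt_append (forall_lt_zero) (forall_lt_single 0 enumX_16_0)) (forall_lt_single 1 enumX_16_1))
    boundX_16

set_option maxRecDepth 100000 in
/-- **`d_X = 8` for `HB90b`** (tier KERNEL (CERTIFIED)): the CSS code of the certificate has X-distance exactly 8. -/
theorem dX_eq_bz : (HB90b.cert.code (HB90b.cert.commOK_of_checkStructure (by decide +kernel))).dX = 8 :=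
  HB90b.cert.dX_code_of_bz HB90b.bzData (by decide +kernel) bzXStruct_ok bzXLen_ok
    (forall_lt_append (forall_lt_append (forall_lt_append (forall_lt_append (forall_lt_append (forall_lt_append (forall_lt_append (forall_lt_append (forall_lt_append (forall_lt_append (forall_lt_append (forall_lt_append (forall_lt_append (forall_lt_append (forall_lt_append (forall_lt_append (forall_lt_append (forall_lt_zero) (forall_lt_single 0 blkX_0)) (forall_lt_single 1 blkX_1)) (forall_lt_single 2 blkX_2)) (forall_lt_single 3 blkX_3)) (forall_lt_single 4 blkX_4)) (forall_lt_single 5 blkX_5)) (forall_lt_single 6 blkX_6)) (forall_lt_single 7 blkX_7)) (forall_lt_single 8 blkX_8)) (forall_lt_single 9 blkX_9)) (forall_lt_single 10 blkX_10)) (forall_lt_single 11 blkX_11)) (forall_lt_single 12 blkX_12)) (forall_lt_single 13 blkX_13)) (forall_lt_single 14 blkX_14)) (forall_lt_single 15 blkX_15)) (forall_lt_single 16 blkX_16))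

end Summit.Ventures.QEC.Census.HB90b
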